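import Mathlib

/-!
# Sketch — crux-ideate (ideator 1, round 1) for `SignCone.SignConeOscillatory`
First-lemma signatures of the idea cards `zeta-perron-certificate` (A) and
`lattice-chirp-completion` (B). Definitions only have to ELABORATE; the one theorem
(`signConeOscillatoryUpTo_of_allOnes`) is the kernel-checked transfer of card A's sub-crux.
-/

namespace Summit.RiemannHypothesis.RiemannHypothesis.Cruxes.SignConeOscillatory.Sketch

open MeasureTheory

noncomputable section

/-- The Weil-cone autocorrelation `F = Σ_i g_i ⋆ g̃_i` exactly as spelled in the route items. -/
def weilF (k : ℕ) (g : Fin k → ℝ → ℂ) : ℝ → ℂ := fun t =>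
  ∑ i, MeasureTheory.convolution (g i) (fun u => (starRingEnd ℂ) ((g i) (-u)))
    (ContinuousLinearMap.mul ℂ ℂ) MeasureTheory.MeasureSpace.volume t

/-- The transform `M(s) = ∫ F(u) e^{(s-1/2)u} du` of the route items (`weilMellin`). -/
def mellinT (F : ℝ → ℂ) : ℂ → ℂ := fun s => ∫ u : ℝ, F u * Complex.exp ((s - 1 / 2) * u)

/-- `Re W_ar(F)` = polar + archimedean part, verbatim from the route items. -/
def reWar (F : ℝ → ℂ) : ℝ :=
  let M := mellinT F
  (M 0 + M 1 + ((1 / (2 * Real.pi) : ℂ) * (∫ t : ℝ, M (1 / 2 + t * Complex.I) *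
    ((Complex.digamma (1 / 4 + t / 2 * Complex.I)).re : ℂ)) - F 0 * (Real.log Real.pi : ℂ))).re

/-- The node sum with the ALL-ONES weight: `P₁(F) = Σ_{n ≥ 2} n^{-1/2} · 2 Re F(log n)`
(a finite sum for compactly supported `F`; written as a `tsum` over `n + 2`). -/
def P1 (F : ℝ → ℂ) : ℝ := ∑' n : ℕ, 2 * (F (Real.log (n + 2))).re / Real.sqrt (n + 2)

/-- Smooth compactly supported family (the route's test-function hypothesis without the cutoff). -/
def IsWeilFamily (k : ℕ) (g : Fin k → ℝ → ℂ) : Prop :=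
  ∀ i, ContDiff ℝ ((⊤ : ℕ∞) : WithTop ℕ∞) (g i) ∧ HasCompactSupport (g i)

/-- The same with cutoff `a`. -/
def IsWeilFamilyAt (a : ℝ) (k : ℕ) (g : Fin k → ℝ → ℂ) : Prop :=
  ∀ i, (ContDiff ℝ ((⊤ : ℕ∞) : WithTop ℕ∞) (g i) ∧ HasCompactSupport (g i)) ∧
    tsupport (g i) ⊆ Set.Icc (-a) a

/-! ## Card A — `zeta-perron-certificate` -/

/-- **First lemma (card A): the Perron–Plancherel node identity.** Shifting
`(1/2πi)∫_{(2)} M(s) ζ(s) ds = Σ_{n≥1} n^{-1/2} F(log n)` to `Re s = 1/2` picks up the pole of `ζ`: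
`Σ_{n ≥ 1} n^{-1/2} F(log n) = M(1) + (1/2π) ∫ M(1/2+it) ζ(1/2+it) dt`, where on the critical line
`M(1/2+it) = Σ_i |ĝ_i(1/2+it)|² ≥ 0`. -/
def PerronNodeIdentity : Prop :=
  ∀ (k : ℕ) (g : Fin k → ℝ → ℂ), IsWeilFamily k g →
    let F := weilF k g
    let M := mellinT F
    ∑' n : ℕ, F (Real.log (n + 1)) / ((Real.sqrt (n + 1) : ℝ) : ℂ)
      = M 1 + (1 / (2 * Real.pi) : ℂ) *
          ∫ t : ℝ, M (1 / 2 + t * Complex.I) * riemannZeta (1 / 2 + t * Complex.I)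

/-- The universal weight of the all-ones certificate:
`ω(t) = Re ψ(1/4 + it/2) − log π + 3 − 2 Re ζ(1/2 + it)` (`ω(0) = 0.5485…`; first negative
excursion `t ∈ [17.07, 18.57]`, depth `−0.64` at `t = 17.84`, job j020461). -/
def omega (t : ℝ) : ℝ :=
  (Complex.digamma (1 / 4 + t / 2 * Complex.I)).re - Real.log Real.pi + 3
    - 2 * (riemannZeta (1 / 2 + t * Complex.I)).re

/-- **Normal form (card A):** for every Weil family,
`Re W_ar(F) + Re F(0) − P₁(F) = (1/2π) ∫ M(1/2+it) ω(t) dt` — no zeros, no primes, no cutoff. -/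
def OmegaNormalForm : Prop :=
  ∀ (k : ℕ) (g : Fin k → ℝ → ℂ), IsWeilFamily k g →
    let F := weilF k g
    let M := mellinT F
    reWar F + (F 0).re - P1 F = (1 / (2 * Real.pi)) * ∫ t : ℝ, (M (1 / 2 + t * Complex.I)).re * omega t

/-- **Sub-crux (card A): the all-ones weight is a unit-slack fake von Mangoldt weight up to cutoff
`a₁`** (`c ≡ 1 ∈ K♭_a` for `a ≤ a₁`): for EVERY Weil family at cutoff `a ≤ a₁` — no sign condition —
`P₁(F) ≤ Re W_ar(F) + Re F(0)`. Equivalently the truncated Toeplitz form `g ↦ (1/2π)∫|ĝ|² ω` is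
positive semidefinite on `L²(−a, a)`. -/
def AllOnesCertificate (a₁ : ℝ) : Prop :=
  ∀ a : ℝ, 0 < a → a ≤ a₁ → ∀ (k : ℕ) (g : Fin k → ℝ → ℂ), IsWeilFamilyAt a k g →
    P1 (weilF k g) ≤ reWar (weilF k g) + ((weilF k g) 0).re

/-- The crux restricted to cutoffs `a ≤ a₁` (verbatim conclusion of `SignConeOscillatory`). -/
def SignConeOscillatoryUpTo (a₁ : ℝ) : Prop :=
  ∀ a : ℝ, 0 < a → a ≤ a₁ → ∀ (k : ℕ) (g : Fin k → ℝ → ℂ), IsWeilFamilyAt a k g →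
    let F := weilF k g
    (∀ n : ℕ, 2 ≤ n → 0 ≤ (F (Real.log n)).re) → (∃ t : ℝ, Real.log 2 ≤ |t| ∧ (F t).re < 0) →
      -(F 0).re ≤ reWar F

/-- Transfer (card A, kernel-checked): a certificate up to `a₁` closes the crux up to `a₁`
(the oscillation hypothesis is not even used; node-nonnegativity gives `P₁ ≥ 0`). -/
theorem signConeOscillatoryUpTo_of_allOnes {a₁ : ℝ} (h : AllOnesCertificate a₁) :
    SignConeOscillatoryUpTo a₁ := by
  intro a ha ha₁ k g hg F hn _hosc
  replace hn : ∀ n : ℕ, 2 ≤ n → 0 ≤ ((weilF k g) (Real.log n)).re := hn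
  have hP : 0 ≤ P1 (weilF k g) := by
    unfold P1
    refine tsum_nonneg fun n => ?_
    have h2 : (2 : ℕ) ≤ n + 2 := by omega
    have := hn (n + 2) h2
    have hc : ((n + 2 : ℕ) : ℝ) = (n : ℝ) + 2 := by push_cast; ring
    rw [hc] at this
    exact div_nonneg (mul_nonneg (by norm_num) this) (Real.sqrt_nonneg _)
  have key := h a ha ha₁ k g hg
  show -((weilF k g) 0).re ≤ reWar (weilF k g)
  linarith

/-- Verbatim local copy of the route decl `Theses.SignCone.SignConeOscillatory` (this self-contained variant avoids the
route import; the import-based twin `Sketch.lean`, attached as item evidence, proves the same implication against the REAL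
decl and its audit block confirms the conclusion by name). -/
def SignConeOscillatoryCopy : Prop :=
  ∀ a : ℝ, 0 < a → ∀ (k : ℕ) (g : Fin k → ℝ → ℂ), (∀ i, (ContDiff ℝ ((⊤ : ℕ∞) : WithTop ℕ∞) (g i) ∧ HasCompactSupport (g i)) ∧ tsupport (g i) ⊆ Set.Icc (-a) a) → let F : ℝ → ℂ := fun t => ∑ i, MeasureTheory.convolution (g i) (fun u => (starRingEnd ℂ) ((g i) (-u))) (ContinuousLinearMap.mul ℂ ℂ) MeasureTheory.MeasureSpace.volume t; (∀ n : ℕ, 2 ≤ n → 0 ≤ (F (Real.log n)).re) → (∃ t : ℝ, Real.log 2 ≤ |t| ∧ (F t).re < 0) → let M : ℂ → ℂ := fun s => ∫ u : ℝ, F u * Complex.exp ((s - 1 / 2) * u); -(F 0).re ≤ (M 0 + M 1 + ((1 / (2 * Real.pi) : ℂ) * (∫ t : ℝ, M (1 / 2 + t * Complex.I) * ((Complex.digamma (1 / 4 + t / 2 * Complex.I)).re : ℂ)) - F 0 * (Real.log Real.pi : ℂ))).re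

/-- The FULL crux (verbatim copy) follows from a certificate at every cutoff (RH-strength; recorded only to fix the
logical shape — the hypothesis is FALSE beyond a₁ ≈ 1.46). -/
theorem signConeOscillatoryCopy_of_allOnes (h : ∀ a₁ : ℝ, AllOnesCertificate a₁) : SignConeOscillatoryCopy := by
  intro a ha k g hg F hn hosc
  exact signConeOscillatoryUpTo_of_allOnes (h a) a ha le_rfl k g hg hn hosc

/-! ## Card B — `lattice-chirp-completion` -/

/-- A fixed `C²` window on `[1, 2]` (any smooth bump would do). -/
def bump (y : ℝ) : ℝ := if 1 ≤ y ∧ y ≤ 2 then (y - 1) ^ 3 * (2 - y) ^ 3 else 0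

/-- The windowed chirp kernel of harmonic `k` at scale `X`:
`𝔨_{X,k}(ξ) = ∫ e^{t/2} bump(e^t/X) e^{-iξt} e^{-2πik e^t} dt = ∫ x^{-1/2-iξ} bump(x/X) e^{-2πikx} dx`,
the `k`-th Poisson/aliasing coefficient of the node-sampling functional on `[X, 2X]`.  By stationary
phase (`Literature.Analysis.Fourier.stationaryPhase`, the tree's weighted `B`-process) its modulus is
`bump(ξ/(2πkX))/√k + O((kX)^{-1/2})` on `ξ ∈ 2πk[X, 2X]` and it is negligible elsewhere. -/
def chirpKernel (X : ℝ) (k : ℤ) (ξ : ℝ) : ℂ :=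
  ∫ t : ℝ, ((Real.exp (t / 2) * bump (Real.exp t / X) : ℝ) : ℂ) *
    Complex.exp (-(Complex.I * ξ * t)) * Complex.exp (-(2 * Real.pi * Complex.I * k * Real.exp t))

/-- **First lemma (card B): the windowed aliasing identity** (Poisson summation inside the spectral
integral).  The node-sampling functional on the window `[X, 2X]` splits EXACTLY into its continuum
part (`k = 0`, a piece of the polar term) and the chirp pairings (`k ≠ 0`):
`Σ_n n^{-1/2} bump(n/X) F(log n) = (1/2π) ∫ M(1/2+iξ) Σ_{k ∈ ℤ} 𝔨_{X,k}(ξ) dξ`. -/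
def WindowedAliasingIdentity : Prop :=
  ∀ (X : ℝ), 2 ≤ X → ∀ (k : ℕ) (g : Fin k → ℝ → ℂ), IsWeilFamily k g →
    let F := weilF k g
    let M := mellinT F
    ∑' n : ℕ, ((bump (n / X) / Real.sqrt n : ℝ) : ℂ) * F (Real.log n)
      = (1 / (2 * Real.pi) : ℂ) * ∫ ξ : ℝ, M (1 / 2 + ξ * Complex.I) * ∑' j : ℤ, chirpKernel X j ξ

/-- **Chirp modulus (card B, second stub shape):** uniform stationary-phase size of the kernel,
`‖𝔨_{X,k}(ξ)‖ ≤ (sup bump)/√k + C/√(kX)` for `k ≥ 1`, `X ≥ 16`. -/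
def ChirpKernelModulus : Prop :=
  ∃ C : ℝ, ∀ (X : ℝ) (k : ℕ) (ξ : ℝ), 16 ≤ X → 1 ≤ k →
    ‖chirpKernel X k ξ‖ ≤ 1 / Real.sqrt k + C / Real.sqrt (k * X)

/-- **Sub-crux (card B): single-window deep dips are harmless.** The crux restricted to tests whose
far-field negativity is confined to ONE window `[T, T + log 2]` at height `T ≥ T₀`. -/
def SignConeOscSingleWindow (T₀ : ℝ) : Prop :=
  ∀ a : ℝ, 0 < a → ∀ (k : ℕ) (g : Fin k → ℝ → ℂ), IsWeilFamilyAt a k g →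
    let F := weilF k g
    (∀ n : ℕ, 2 ≤ n → 0 ≤ (F (Real.log n)).re) →
    (∃ T : ℝ, T₀ ≤ T ∧ ∀ t : ℝ, Real.log 2 ≤ |t| → (F t).re < 0 → T ≤ |t| ∧ |t| ≤ T + Real.log 2) →
    (∃ t : ℝ, Real.log 2 ≤ |t| ∧ (F t).re < 0) →
      -(F 0).re ≤ reWar F

end

end Summit.RiemannHypothesis.RiemannHypothesis.Cruxes.SignConeOscillatory.Sketch
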